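import Summits.NavierStokesRegularity.TurbBounds.SpectralFormFreeSlip
import Summits.NavierStokesRegularity.TurbBounds.FSU1.Mode.M01Calculus
import Summits.NavierStokesRegularity.TurbBounds.FSU1.Mode.M02Poincare
import Summits.NavierStokesRegularity.TurbBounds.FSU1.Mode.M03Defs
import Summits.NavierStokesRegularity.TurbBounds.FSU1.Mode.M04Young
import Summits.NavierStokesRegularity.TurbBounds.FSU1.Mode.M06PhiRegime

/-!
# FS-U1″ mode lemma — Schur (`TurbBounds/FSU1/Mode/M14Schur.lean`)

FS-PROOF-DRAFT §3.8: the Schur step, endpoint monotonicity over a cell, layer Poincaré for the vorticity and the half-cell Schur composition, `Eu 1 = E₁`.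

Cell-made mathematics of FS-PROOF-DRAFT §3 (pub-turb-sos), kernel-checked; generated from the design compose file
`StageF_compose.check.lean` (96c4b9bf…) by `build_mode_split.py`.  HONEST FRAMING: rigorous bounds for the stated PDE and boundary conditions; no claim about physical turbulence beyond the bound.
-/

open Real intervalIntegral MeasureTheory Set

namespace Summit.NavierStokesRegularity.TurbBounds.FSU1.Mode

open Summit.NavierStokesRegularity.TurbBounds.SpectralFormFreeSlip

/-- Weighted Cauchy–Schwarz in two terms: `(c₁S + c₂R)² ≤ (c₁²/A + c₂²/B)(A S² + B R²)` for `A, B > 0`. -/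
theorem cs_two (c₁ c₂ S R A B : ℝ) (hA : 0 < A) (hB : 0 < B) :
    (c₁ * S + c₂ * R) ^ 2 ≤ (c₁ ^ 2 / A + c₂ ^ 2 / B) * (A * S ^ 2 + B * R ^ 2) := by
  have hA' : A ≠ 0 := hA.ne'
  have hB' : B ≠ 0 := hB.ne'
  -- expand: RHS - LHS = (c₁²B/A) R² ... = (c₁ B S' ...)²/(AB); do it via the identity with u = c₁/A·?, use nlinarith on cleared denominators
  have key : 0 ≤ (c₁ * B * R - c₂ * A * S) ^ 2 := sq_nonneg _
  have hAB : 0 < A * B := mul_pos hA hB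
  rw [div_add_div _ _ hA' hB', div_mul_eq_mul_div, le_div_iff₀ hAB]
  nlinarith [key, sq_nonneg (c₁ * S + c₂ * R), mul_pos hA hB]

/-- **Schur step (FS-PROOF-DRAFT §3.8).** -/
theorem schur_step (X S R c₁ c₂ σ ν ε : ℝ) (hσ : 0 < σ) (hν : 0 < ν) (hε : 0 < ε) (hε1 : ε < 1)
    (h : c₁ ^ 2 / ((1 - ε) * σ) + c₂ ^ 2 / (ε * ν) ≤ 1) :
    0 ≤ X ^ 2 - 2 * X * (c₁ * S + c₂ * R) + (1 - ε) * σ * S ^ 2 + ε * ν * R ^ 2 := by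
  set A := (1 - ε) * σ with hAdef
  set B := ε * ν with hBdef
  have hA : 0 < A := mul_pos (by linarith) hσ
  have hB : 0 < B := mul_pos hε hν
  have hq : 0 ≤ A * S ^ 2 + B * R ^ 2 := by positivity
  have hm : (c₁ * S + c₂ * R) ^ 2 ≤ A * S ^ 2 + B * R ^ 2 := by
    calc (c₁ * S + c₂ * R) ^ 2 ≤ (c₁ ^ 2 / A + c₂ ^ 2 / B) * (A * S ^ 2 + B * R ^ 2) := cs_two c₁ c₂ S R A B hA hB
      _ ≤ 1 * (A * S ^ 2 + B * R ^ 2) := by gcongr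
      _ = A * S ^ 2 + B * R ^ 2 := one_mul _
  have : X ^ 2 - 2 * X * (c₁ * S + c₂ * R) + (1 - ε) * σ * S ^ 2 + ε * ν * R ^ 2
      = (X - (c₁ * S + c₂ * R)) ^ 2 + ((A * S ^ 2 + B * R ^ 2) - (c₁ * S + c₂ * R) ^ 2) := by
    rw [hAdef, hBdef]; ring
  rw [this]
  nlinarith [sq_nonneg (X - (c₁ * S + c₂ * R)), hm]


/-- `m̃(κ) = √(1 + c/κ²)` is decreasing in `κ > 0` (for `c ≥ 0`). -/
theorem mtilde_anti {c κ₁ κ₂ : ℝ} (hc : 0 ≤ c) (h0 : 0 < κ₁) (h12 : κ₁ ≤ κ₂) :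
    Real.sqrt (1 + c / κ₂ ^ 2) ≤ Real.sqrt (1 + c / κ₁ ^ 2) := by
  apply Real.sqrt_le_sqrt
  have : c / κ₂ ^ 2 ≤ c / κ₁ ^ 2 := div_le_div_of_nonneg_left hc (by positivity) (pow_le_pow_left₀ h0.le h12 2)
  linarith

/-- `Q(κ) = R(√(κ²+c) − κ)/2` is decreasing in `κ ≥ 0` (for `R ≥ 0`, `c > 0`). -/
theorem Qfn_anti {c R κ₁ κ₂ : ℝ} (hR : 0 ≤ R) (hc : 0 < c) (h0 : 0 ≤ κ₁) (h12 : κ₁ ≤ κ₂) :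
    R * (Real.sqrt (κ₂ ^ 2 + c) - κ₂) / 2 ≤ R * (Real.sqrt (κ₁ ^ 2 + c) - κ₁) / 2 := by
  obtain ⟨hs10, hs12, hks1, _⟩ := sqrt_facts hc h0
  obtain ⟨hs20, hs22, hks2, _⟩ := sqrt_facts hc (h0.trans h12)
  set s₁ := Real.sqrt (κ₁ ^ 2 + c)
  set s₂ := Real.sqrt (κ₂ ^ 2 + c)
  -- c = (sᵢ − κᵢ)(sᵢ + κᵢ) and s₂ + κ₂ ≥ s₁ + κ₁ > 0
  have hss : s₁ ≤ s₂ := Real.sqrt_le_sqrt (by nlinarith)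
  have hd : s₂ - κ₂ ≤ s₁ - κ₁ := by
    have e1 : (s₁ - κ₁) * (s₁ + κ₁) = c := by nlinarith
    have e2 : (s₂ - κ₂) * (s₂ + κ₂) = c := by nlinarith
    have hp1 : 0 < s₁ + κ₁ := by linarith
    by_contra h
    push Not at h
    have : (s₁ - κ₁) * (s₁ + κ₁) < (s₂ - κ₂) * (s₂ + κ₂) :=
      calc (s₁ - κ₁) * (s₁ + κ₁) < (s₂ - κ₂) * (s₁ + κ₁) := mul_lt_mul_of_pos_right h hp1
        _ ≤ (s₂ - κ₂) * (s₂ + κ₂) := mul_le_mul_of_nonneg_left (by linarith) (by linarith)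
    linarith
  have := mul_le_mul_of_nonneg_left hd hR
  linarith

/-- An even polynomial with non-negative coefficients is non-negative … -/
theorem evenPoly_foldr_nonneg (cs : List ℚ) (hcs : ∀ q ∈ cs, 0 ≤ q) (x : ℝ) :
    0 ≤ cs.foldr (fun (co : ℚ) (acc : ℝ) => (co : ℝ) + x ^ 2 * acc) 0 := by
  induction cs with
  | nil => simp
  | cons q qs ih =>
    simp only [List.foldr_cons]
    have hq : (0 : ℝ) ≤ q := by exact_mod_cast hcs q (by simp)
    have := ih (fun r hr => hcs r (by simp [hr]))
    positivity

/-- … and increasing in `|x|`: `0 ≤ x ≤ y ⇒ poly x ≤ poly y`. -/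
theorem evenPoly_foldr_mono (cs : List ℚ) (hcs : ∀ q ∈ cs, 0 ≤ q) {x y : ℝ} (hx : 0 ≤ x) (hxy : x ≤ y) :
    cs.foldr (fun (co : ℚ) (acc : ℝ) => (co : ℝ) + x ^ 2 * acc) 0 ≤ cs.foldr (fun (co : ℚ) (acc : ℝ) => (co : ℝ) + y ^ 2 * acc) 0 := by
  induction cs with
  | nil => simp
  | cons q qs ih =>
    simp only [List.foldr_cons]
    have hqs : ∀ r ∈ qs, 0 ≤ r := fun r hr => hcs r (by simp [hr])
    have h1 := ih hqs
    have h2 := evenPoly_foldr_nonneg qs hqs x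
    have h3 : x ^ 2 ≤ y ^ 2 := pow_le_pow_left₀ hx hxy 2
    nlinarith [mul_le_mul h3 h1 h2 (by positivity)]


/-! ## A.3 Layer Poincaré for the vorticity and the half-cell Schur composition -/

/-- The vorticity `vort k V` vanishes at `z = 0` when `V 0 = 0` and `V'' 0 = 0`. -/
theorem vort_zero {V : ℝ → ℝ} {k : ℝ} (hV0 : V 0 = 0) (hV2 : deriv (deriv V) 0 = 0) : vort k V 0 = 0 := by
  simp [vort, hV0, hV2]

/-- `(απ²/(4δ²) + αk² + β₀)·∫₀^δ Ω² ≤ W_half` (quarter-wave Poincaré on the layer, `Ω(0)=0`, plus `δ ≤ 1/2`). -/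
theorem layer_poincare_vort {α β₀ δ k : ℝ} {V : ℝ → ℝ} (hα : 0 ≤ α) (hβ : 0 ≤ α * k ^ 2 + β₀) (hδ : 0 < δ)
    (hδh : δ ≤ 1 / 2) (hV : ContDiff ℝ 3 V) (hV0 : V 0 = 0) (hV2 : deriv (deriv V) 0 = 0) :
    (α * (π ^ 2 / (4 * δ ^ 2)) + (α * k ^ 2 + β₀)) * ∫ z in (0:ℝ)..δ, vort k V z ^ 2 ≤ Wh α β₀ k V := by
  have hΩ1 : ContDiff ℝ 1 (vort k V) := contDiff_one_vort hV k
  have hΩc : Continuous (vort k V) := continuous_vort hV k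
  have hΩ'c : Continuous (deriv (vort k V)) := continuous_deriv_vort hV k
  have hder : ∀ x, HasDerivAt (vort k V) (deriv (vort k V) x) x := fun x =>
    ((hΩ1.differentiable (by simp)) x).hasDerivAt
  have hΩc2 : Continuous fun z => vort k V z ^ 2 := hΩc.pow 2
  have hΩ'c2 : Continuous fun z => deriv (vort k V) z ^ 2 := hΩ'c.pow 2
  have hP := quarter_wave_poincare hder hΩ'c (vort_zero hV0 hV2) hδ
  have hcst : (π / (2 * δ)) ^ 2 = π ^ 2 / (4 * δ ^ 2) := by ring
  rw [hcst] at hP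
  have I1' : ∀ a b : ℝ, IntervalIntegrable (fun z => α * deriv (vort k V) z ^ 2) volume a b :=
    fun a b => (continuous_const.mul hΩ'c2).intervalIntegrable a b
  have I2' : ∀ a b : ℝ, IntervalIntegrable (fun z => (α * k ^ 2 + β₀) * vort k V z ^ 2) volume a b :=
    fun a b => (continuous_const.mul hΩc2).intervalIntegrable a b
  have I1 := I1' 0 (1/2)
  have I2 := I2' 0 (1/2)
  have hsplit : Wh α β₀ k V = (∫ z in (0:ℝ)..1/2, α * deriv (vort k V) z ^ 2)
      + ∫ z in (0:ℝ)..1/2, (α * k ^ 2 + β₀) * vort k V z ^ 2 := by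
    unfold Wh; rw [← intervalIntegral.integral_add I1 I2]
  have hA : (∫ z in (0:ℝ)..δ, α * deriv (vort k V) z ^ 2) ≤ ∫ z in (0:ℝ)..1/2, α * deriv (vort k V) z ^ 2 := by
    rw [← intervalIntegral.integral_add_adjacent_intervals (I1' 0 δ) (I1' δ (1/2))]
    have : 0 ≤ ∫ z in δ..(1/2:ℝ), α * deriv (vort k V) z ^ 2 :=
      intervalIntegral.integral_nonneg hδh fun z _ => by positivity
    linarith
  have hB : (∫ z in (0:ℝ)..δ, (α * k ^ 2 + β₀) * vort k V z ^ 2)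
      ≤ ∫ z in (0:ℝ)..1/2, (α * k ^ 2 + β₀) * vort k V z ^ 2 := by
    rw [← intervalIntegral.integral_add_adjacent_intervals (I2' 0 δ) (I2' δ (1/2))]
    have : 0 ≤ ∫ z in δ..(1/2:ℝ), (α * k ^ 2 + β₀) * vort k V z ^ 2 :=
      intervalIntegral.integral_nonneg hδh fun z _ => by
        exact mul_nonneg hβ (sq_nonneg _)
    linarith
  have hA' : α * (π ^ 2 / (4 * δ ^ 2)) * (∫ z in (0:ℝ)..δ, vort k V z ^ 2)
      ≤ ∫ z in (0:ℝ)..δ, α * deriv (vort k V) z ^ 2 := by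
    rw [intervalIntegral.integral_const_mul, mul_assoc]
    exact mul_le_mul_of_nonneg_left hP hα
  have hB' : (α * k ^ 2 + β₀) * (∫ z in (0:ℝ)..δ, vort k V z ^ 2)
      = ∫ z in (0:ℝ)..δ, (α * k ^ 2 + β₀) * vort k V z ^ 2 := by
    rw [intervalIntegral.integral_const_mul]
  rw [hsplit, add_mul]
  linarith

/-- Half-cell non-negativity from a stiffness bound, the two coupling bounds, the layer Poincaré bound and the Schur condition. -/
theorem half_nonneg {α β₀ δ k σ C₁ C₂ ε : ℝ} {V Θ : ℝ → ℝ} (hα : 0 < α) (hβ₀ : 0 < β₀) (hδ : 0 < δ)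
    (hδh : δ ≤ 1 / 2) (hV : ContDiff ℝ 3 V) (hΘ : ContDiff ℝ 1 Θ) (hV0 : V 0 = 0)
    (hV2 : deriv (deriv V) 0 = 0) (hσ : 0 < σ) (hC1 : 0 ≤ C₁) (hC2 : 0 ≤ C₂) (hε : 0 < ε) (hε1 : ε < 1)
    (hS : σ * deriv V 0 ^ 2 ≤ Wh α β₀ k V)
    (hc1 : |1 / δ * ∫ z in (0:ℝ)..δ, deriv V 0 / k * Real.sinh (k * z) * Θ z|
        ≤ C₁ * |deriv V 0| * Real.sqrt (∫ z in (0:ℝ)..δ, deriv Θ z ^ 2))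
    (hc2 : |1 / δ * ∫ z in (0:ℝ)..δ, (V z - deriv V 0 / k * Real.sinh (k * z)) * Θ z|
        ≤ C₂ * Real.sqrt (∫ z in (0:ℝ)..δ, vort k V z ^ 2) * Real.sqrt (∫ z in (0:ℝ)..δ, deriv Θ z ^ 2))
    (hcond : (C₁ / 2) ^ 2 / ((1 - ε) * σ)
        + (C₂ / 2) ^ 2 / (ε * (α * (π ^ 2 / (4 * δ ^ 2)) + (α * k ^ 2 + β₀))) ≤ 1) :
    0 ≤ Eh α β₀ δ k V Θ := by
  have hΘc : Continuous Θ := hΘ.continuous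
  have hΘ' : Continuous (deriv Θ) := continuous_deriv_of_contDiff_one hΘ
  have hVc : Continuous V := hV.continuous
  have hΩ : Continuous (vort k V) := continuous_vort hV k
  have hΩ' : Continuous (deriv (vort k V)) := continuous_deriv_vort hV k
  have hsinh : Continuous (fun z : ℝ => Real.sinh (k * z)) :=
    Real.continuous_sinh.comp (continuous_const.mul continuous_id')
  have hΘ'2 : Continuous fun z => deriv Θ z ^ 2 := hΘ'.pow 2
  have hΩ2 : Continuous fun z => vort k V z ^ 2 := hΩ.pow 2
  have hΩ'2 : Continuous fun z => deriv (vort k V) z ^ 2 := hΩ'.pow 2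
  set ν : ℝ := α * (π ^ 2 / (4 * δ ^ 2)) + (α * k ^ 2 + β₀) with hνdef
  have hν : 0 < ν := by rw [hνdef]; positivity
  set X2 : ℝ := ∫ z in (0:ℝ)..1/2, deriv Θ z ^ 2 with hX2
  set Xw2 : ℝ := ∫ z in (0:ℝ)..δ, deriv Θ z ^ 2 with hXw2
  set R2 : ℝ := ∫ z in (0:ℝ)..δ, vort k V z ^ 2 with hR2
  set W : ℝ := Wh α β₀ k V with hW
  set T : ℝ := 1 / δ * ∫ z in (0:ℝ)..δ, V z * Θ z with hT
  have hX2nn : 0 ≤ X2 := intervalIntegral.integral_nonneg (by norm_num) fun z _ => sq_nonneg _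
  have hXw2nn : 0 ≤ Xw2 := intervalIntegral.integral_nonneg hδ.le fun z _ => sq_nonneg _
  have hR2nn : 0 ≤ R2 := intervalIntegral.integral_nonneg hδ.le fun z _ => sq_nonneg _
  have hXw2le : Xw2 ≤ X2 := by
    rw [hX2, hXw2, ← intervalIntegral.integral_add_adjacent_intervals (b := δ)
      (hΘ'2.intervalIntegrable 0 δ) (hΘ'2.intervalIntegrable δ (1/2))]
    have : 0 ≤ ∫ z in δ..(1/2:ℝ), deriv Θ z ^ 2 :=
      intervalIntegral.integral_nonneg hδh fun z _ => sq_nonneg _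
    linarith
  set X : ℝ := Real.sqrt X2 with hX
  set Xw : ℝ := Real.sqrt Xw2 with hXw
  set R : ℝ := Real.sqrt R2 with hR
  set S : ℝ := |deriv V 0| with hSdef
  have hX0 : 0 ≤ X := Real.sqrt_nonneg _
  have hR0 : 0 ≤ R := Real.sqrt_nonneg _
  have hS0 : 0 ≤ S := abs_nonneg _
  have hXwX : Xw ≤ X := Real.sqrt_le_sqrt hXw2le
  have hXsq : X ^ 2 = X2 := Real.sq_sqrt hX2nn
  have hRsq : R ^ 2 = R2 := Real.sq_sqrt hR2nn
  have hSsq : S ^ 2 = deriv V 0 ^ 2 := sq_abs _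
  -- `Eh = X2 + W − T`
  have I1 : IntervalIntegrable (fun z => deriv Θ z ^ 2) volume 0 (1/2) := hΘ'2.intervalIntegrable _ _
  have I2 : IntervalIntegrable (fun z => α * deriv (vort k V) z ^ 2 + (α * k ^ 2 + β₀) * vort k V z ^ 2)
      volume 0 (1/2) :=
    ((continuous_const.mul hΩ'2).add (continuous_const.mul hΩ2)).intervalIntegrable _ _
  have hsplit : (∫ z in (0:ℝ)..1/2, (deriv Θ z ^ 2 + α * deriv (vort k V) z ^ 2
      + (α * k ^ 2 + β₀) * vort k V z ^ 2)) = X2 + W := by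
    rw [hX2, hW]; unfold Wh
    rw [← intervalIntegral.integral_add I1 I2]
    exact intervalIntegral.integral_congr fun z _ => by ring
  have hEh : Eh α β₀ δ k V Θ = X2 + W - T := by unfold Eh; rw [hsplit]
  -- split `T` into slope and remainder parts
  have J1 : IntervalIntegrable (fun z => deriv V 0 / k * Real.sinh (k * z) * Θ z) volume 0 δ :=
    ((continuous_const.mul hsinh).mul hΘc).intervalIntegrable _ _
  have J2 : IntervalIntegrable (fun z => (V z - deriv V 0 / k * Real.sinh (k * z)) * Θ z) volume 0 δ :=
    ((hVc.sub (continuous_const.mul hsinh)).mul hΘc).intervalIntegrable _ _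
  have hTsplit : T = 1 / δ * (∫ z in (0:ℝ)..δ, deriv V 0 / k * Real.sinh (k * z) * Θ z)
      + 1 / δ * ∫ z in (0:ℝ)..δ, (V z - deriv V 0 / k * Real.sinh (k * z)) * Θ z := by
    rw [hT, ← mul_add, ← intervalIntegral.integral_add J1 J2]
    congr 1
    exact intervalIntegral.integral_congr fun z _ => by ring
  have hTle : T ≤ (C₁ * S + C₂ * R) * X := by
    have a1 := le_abs_self (1 / δ * ∫ z in (0:ℝ)..δ, deriv V 0 / k * Real.sinh (k * z) * Θ z)
    have a2 := le_abs_self (1 / δ * ∫ z in (0:ℝ)..δ, (V z - deriv V 0 / k * Real.sinh (k * z)) * Θ z)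
    have b1 : C₁ * S * Xw ≤ C₁ * S * X := mul_le_mul_of_nonneg_left hXwX (mul_nonneg hC1 hS0)
    have b2 : C₂ * R * Xw ≤ C₂ * R * X := mul_le_mul_of_nonneg_left hXwX (mul_nonneg hC2 hR0)
    rw [hTsplit]
    linarith [hc1, hc2]
  -- lower bounds for `W`
  have hWS : σ * S ^ 2 ≤ W := by rw [hSsq]; exact hS
  have hWR : ν * R ^ 2 ≤ W := by
    rw [hRsq, hR2, hW, hνdef]
    exact layer_poincare_vort hα.le (by positivity) hδ hδh hV hV0 hV2
  have hW' : (1 - ε) * (σ * S ^ 2) + ε * (ν * R ^ 2) ≤ W := by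
    have h1 := mul_le_mul_of_nonneg_left hWS (by linarith : (0:ℝ) ≤ 1 - ε)
    have h2 := mul_le_mul_of_nonneg_left hWR hε.le
    linarith
  have sch := schur_step X S R (C₁ / 2) (C₂ / 2) σ ν ε hσ hν hε hε1 hcond
  rw [hEh, ← hXsq]
  linarith [sch, hTle, hW']

/-! ## A.4 `Eu 1 = E₁` (the Young split at `u = 1`) -/

/-- At `u = 1` the Young-split functional `Eu` coincides with `E1` at the rescaled coefficients `a/(Ra√Ra)` and `(b − a²/4)/Ra`. -/
theorem Eu_one_eq_E1 (Ra a b : ℝ) (τp : ℝ → ℝ) (k : ℝ) (v θ : ℝ → ℝ) :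
    Eu 1 Ra a b τp k v θ = E1 (a / (Ra * Real.sqrt Ra)) ((b - a ^ 2 / 4) / Ra) τp k v θ := by
  unfold Eu E1
  refine intervalIntegral.integral_congr fun z _ => ?_
  simp only [fsIntegrand, youngDensity]
  ring

end Summit.NavierStokesRegularity.TurbBounds.FSU1.Mode
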